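import Mathlib
import Summits.NavierStokesRegularity.NavierStokesRegularity.Theorems.FilamentSkeletonRssClause13ModelPieceWindow
import Summits.NavierStokesRegularity.NavierStokesRegularity.Theorems.FilamentSkeletonRssClause13ModelBandEstimate

/-!
# Clause 13-J/13-R, brick n3 LAYER C (BAND PIECE, preliminaries): `L²` bookkeeping for one-sided band pieces
# `P = a∗Y + i·(b∗Y)` built from TWO real kernels

Route `FilamentSkeletonRss`, ∃-side clause 13 (`Clause13RNearStraightL` stmt-NavierStokesRegularity-23612; typing-agnostic); design
`filament-plan/DESIGN-28296-model-gluing-g16-v2-addendum.md` §A (BAND piece, task C4).  The band estimate `model_band_estimate` (p694551) is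
ORIENTED (its gain is `𝔖′(z√q) ≥ σ₀`, and `𝔖′` is odd), so the band pieces must have spectral profiles supported on ONE half-line; such a
profile has a complex kernel, which we write as `a + i b` with `a, b` REAL so that all real-kernel piece lemmas (Layer B/C) apply to `a∗Y` and
`b∗Y` separately.  This file supplies the bookkeeping:

* §1 `l2_weight_piece_le` (`‖(τ−c)(k∗Y)‖₂ ≤ √2(‖k‖₁‖(τ−c)Y‖₂ + ‖t k‖₁‖Y‖₂)`), `l2_boundedMultiplier_le` (`‖βf‖₂ ≤ b‖f‖₂`),
  `integrable_smoothingKernel_mul_of_integrable`;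
* §2 `memLp_modelOperator_piece` (`𝓛(k∗Y) ∈ L²`) and `l2_modelOperator_negConj_le`: flipping the sign of the conjugate-linear coefficient costs
  `‖𝓛⁻Y‖₂ ≤ ‖𝓛Y‖₂ + 2b₂‖Y‖₂` (needed because `𝓛(iB) = i·𝓛⁻B`);
* §3 `transform_twoKernelPiece_eq`: `(a∗Y + i b∗Y)^(z) = (χ_a(z) + iχ_b(z))·Ŷ(z)`.
Lane ns-filament-19175-p1 g16; `--supports stmt-NavierStokesRegularity-23612 --as helper`.
HONEST FRAMING: bookkeeping about an explicit 1-D model operator attached to a HYPOTHETICAL filament skeleton on the NEGATIVE side of a MODEL route;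
nothing here bears on Navier–Stokes regularity or blow-up.
-/

noncomputable section

open MeasureTheory Real Complex Filter Set
open scoped ComplexConjugate Topology

namespace Summit.NavierStokesRegularity.NavierStokesRegularity.Theorems.MatchedKernel
set_option linter.dupNamespace false

/-! ## §1 Weighted and multiplier `L²` bounds -/

/-- **`‖(τ−c)P‖₂ ≤ √2·(‖k‖₁‖(τ−c)Y‖₂ + ‖t k‖₁‖Y‖₂)`** for `P = k∗Y`. [folklore] -/
theorem l2_weight_piece_le {k : ℝ → ℝ} (hkc : Continuous k) (hki : Integrable k) (hk1 : Integrable fun t => t * k t)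
    {Y : ℝ → ℂ} (hYc : Continuous Y) (hYs : HasCompactSupport Y) (c : ℝ) :
    (∫ x : ℝ, ‖(((x - c : ℝ) : ℂ)) * ∫ y : ℝ, ((k (x - y) : ℝ) : ℂ) * Y y‖ ^ 2) ^ (1 / 2 : ℝ)
      ≤ Real.sqrt 2 * ((∫ t, |k t|) * (∫ y : ℝ, ‖(((y - c : ℝ) : ℂ)) * Y y‖ ^ 2) ^ (1 / 2 : ℝ)
        + (∫ t, |t| * |k t|) * (∫ y : ℝ, ‖Y y‖ ^ 2) ^ (1 / 2 : ℝ)) := by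
  obtain ⟨_, hle⟩ := integral_sq_norm_weight_piece_le hkc hki hk1 hYc hYs c
  have h0 : 0 ≤ ∫ y : ℝ, ‖(((y - c : ℝ) : ℂ)) * Y y‖ ^ 2 := integral_nonneg fun y => by positivity
  have h1 : 0 ≤ ∫ y : ℝ, ‖Y y‖ ^ 2 := integral_nonneg fun y => by positivity
  have hA : 0 ≤ ∫ t, |k t| := integral_nonneg fun t => abs_nonneg _
  have hB : 0 ≤ ∫ t, |t| * |k t| := integral_nonneg fun t => by positivity
  set a : ℝ := (∫ t, |k t|) * (∫ y : ℝ, ‖(((y - c : ℝ) : ℂ)) * Y y‖ ^ 2) ^ (1 / 2 : ℝ) with ha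
  set b : ℝ := (∫ t, |t| * |k t|) * (∫ y : ℝ, ‖Y y‖ ^ 2) ^ (1 / 2 : ℝ) with hb
  have ha0 : 0 ≤ a := by positivity
  have hb0 : 0 ≤ b := by positivity
  have ha2 : a ^ 2 = (∫ t, |k t|) ^ 2 * ∫ y : ℝ, ‖(((y - c : ℝ) : ℂ)) * Y y‖ ^ 2 := by
    rw [ha, mul_pow, ← Real.rpow_natCast ((∫ y : ℝ, ‖(((y - c : ℝ) : ℂ)) * Y y‖ ^ 2) ^ (1 / 2 : ℝ)) 2, ← Real.rpow_mul h0]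
    norm_num
  have hb2 : b ^ 2 = (∫ t, |t| * |k t|) ^ 2 * ∫ y : ℝ, ‖Y y‖ ^ 2 := by
    rw [hb, mul_pow, ← Real.rpow_natCast ((∫ y : ℝ, ‖Y y‖ ^ 2) ^ (1 / 2 : ℝ)) 2, ← Real.rpow_mul h1]
    norm_num
  have hI0 : 0 ≤ ∫ x : ℝ, ‖(((x - c : ℝ) : ℂ)) * ∫ y : ℝ, ((k (x - y) : ℝ) : ℂ) * Y y‖ ^ 2 := integral_nonneg fun x => by positivity
  have hsq : ∫ x : ℝ, ‖(((x - c : ℝ) : ℂ)) * ∫ y : ℝ, ((k (x - y) : ℝ) : ℂ) * Y y‖ ^ 2 ≤ (Real.sqrt 2 * (a + b)) ^ 2 := by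
    rw [mul_pow, Real.sq_sqrt (by norm_num)]
    nlinarith [hle, ha2, hb2, mul_nonneg ha0 hb0]
  calc (∫ x : ℝ, ‖(((x - c : ℝ) : ℂ)) * ∫ y : ℝ, ((k (x - y) : ℝ) : ℂ) * Y y‖ ^ 2) ^ (1 / 2 : ℝ)
      ≤ ((Real.sqrt 2 * (a + b)) ^ 2) ^ (1 / 2 : ℝ) := Real.rpow_le_rpow hI0 hsq (by norm_num)
    _ = Real.sqrt 2 * (a + b) := by
        rw [← Real.sqrt_eq_rpow, Real.sqrt_sq (by positivity)]

/-- **`‖β·f‖₂ ≤ b·‖f‖₂`** for a multiplier with `‖β‖ ≤ b` and `f ∈ L²`. [folklore] -/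
theorem l2_boundedMultiplier_le {β f : ℝ → ℂ} {b : ℝ} (hb : ∀ τ, ‖β τ‖ ≤ b) (hf2 : MemLp f 2 volume) :
    (∫ x : ℝ, ‖β x * f x‖ ^ 2) ^ (1 / 2 : ℝ) ≤ b * (∫ x : ℝ, ‖f x‖ ^ 2) ^ (1 / 2 : ℝ) := by
  have hb0 : 0 ≤ b := (norm_nonneg _).trans (hb 0)
  refine l2_le_of_sq_le hb0 ?_
  rw [← integral_const_mul]
  refine integral_mono_of_nonneg (ae_of_all _ fun x => by positivity)
    (((memLp_two_iff_integrable_sq_norm hf2.1).1 hf2).const_mul _) (ae_of_all _ fun x => ?_)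
  simp only [norm_mul, mul_pow]
  exact mul_le_mul_of_nonneg_right (pow_le_pow_left₀ (norm_nonneg _) (hb x) 2) (by positivity)

/-- `σ ↦ K_q(τ−σ)·F(σ)` is integrable for `F ∈ L¹` (`K_q` is bounded by `2q^{-3/2}`). [folklore] -/
theorem integrable_smoothingKernel_mul_of_integrable {q : ℝ} (hq : 0 < q) {F : ℝ → ℂ} (hF : Integrable F) (τ : ℝ) :
    Integrable fun σ : ℝ => ((((2 * q - (τ - σ) ^ 2) * (((τ - σ) ^ 2 + q) ^ (5 / 2 : ℝ))⁻¹ : ℝ)) : ℂ) * F σ := by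
  refine hF.bdd_mul (c := 2 * (q ^ (3 / 2 : ℝ))⁻¹) ?_ (ae_of_all _ fun σ => ?_)
  · exact (Complex.continuous_ofReal.comp ((continuous_smoothingKernel hq).comp (continuous_const.sub continuous_id))).aestronglyMeasurable
  · rw [Complex.norm_real, Real.norm_eq_abs]; exact abs_smoothingKernel_le_const hq _

/-! ## §2 The model operator on a piece; flipping the conjugate-linear coefficient -/

/-- `𝓛(k∗Y) ∈ L²` for `k` real `C¹`, bounded, `k, k′, t k′ ∈ L¹`, `Y ∈ C¹_c`, `w` differentiable with `w(c) = 0`, `|w′| ≤ Λ`, `β_i` continuous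
bounded. [folklore] -/
theorem memLp_modelOperator_piece {q : ℝ} (hq : 0 < q) (G : ℝ) {k k' : ℝ → ℝ} (hk : ∀ t, HasDerivAt k (k' t) t) (hk'c : Continuous k')
    (hki : Integrable k) (hk'i : Integrable k') (hk'1 : Integrable fun t => t * k' t) {Mk : ℝ} (hkM : ∀ t, |k t| ≤ Mk)
    {Y : ℝ → ℂ} (hY : ContDiff ℝ 1 Y) (hYs : HasCompactSupport Y) (c : ℝ)
    {w : ℝ → ℝ} (hw : Differentiable ℝ w) {Λ : ℝ} (hΛ : ∀ t, |deriv w t| ≤ Λ) (hwc : w c = 0)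
    {β₁ β₂ : ℝ → ℂ} (hβ₁c : Continuous β₁) (hβ₂c : Continuous β₂) {b₁ b₂ : ℝ} (hb₁ : ∀ τ, ‖β₁ τ‖ ≤ b₁) (hb₂ : ∀ τ, ‖β₂ τ‖ ≤ b₂) :
    MemLp (fun x : ℝ => I * (G : ℂ) * ((2 / q : ℂ) * (∫ y : ℝ, ((k (x - y) : ℝ) : ℂ) * Y y)
          - ∫ σ : ℝ, ((((2 * q - (x - σ) ^ 2) * (((x - σ) ^ 2 + q) ^ (5 / 2 : ℝ))⁻¹ : ℝ)) : ℂ) * ∫ y : ℝ, ((k (σ - y) : ℝ) : ℂ) * Y y)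
        - ((w x : ℝ) : ℂ) * (∫ y : ℝ, ((k (x - y) : ℝ) : ℂ) * deriv Y y)
        + β₁ x * (∫ y : ℝ, ((k (x - y) : ℝ) : ℂ) * Y y) + β₂ x * conj (∫ y : ℝ, ((k (x - y) : ℝ) : ℂ) * Y y)) 2 volume := by
  have hkc : Continuous k := continuous_iff_continuousAt.2 fun t => (hk t).continuousAt
  have hYc := hY.continuous
  have hY'c : Continuous (deriv Y) := hY.continuous_deriv le_rfl
  have hP2 := memLp_piece hkc hki hYc hYs
  have hP'c : Continuous fun x : ℝ => ∫ y : ℝ, ((k (x - y) : ℝ) : ℂ) * deriv Y y := continuous_piece hkc hY'c hYs.deriv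
  obtain ⟨hwP'2, _⟩ := l2_weight_pieceDeriv_le hk hk'c hk'i hk'1 hY hYs c
  have hM2 := memLp_modelSelf_piece hq hkc hki hkM hYc hYs
  have hS2 := hM2.const_mul (I * (G : ℂ))
  have hT2 := memLp_slip_mul hP'c.aestronglyMeasurable hwP'2 hw hΛ hwc
  have hB2 := (memLp_boundedMultiplier_mul hβ₁c.aestronglyMeasurable hb₁ hP2).add
    (memLp_boundedMultiplier_mul hβ₂c.aestronglyMeasurable hb₂ (memLp_conj hP2))
  refine ((hS2.sub hT2).add hB2).ae_eq (ae_of_all _ fun x => ?_)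
  simp only [Pi.add_apply, Pi.sub_apply]
  ring

/-- **Flipping the conjugate-linear coefficient**: with `𝓛⁻ = iG·M_q − w∂ + β₁ − β₂·conj` one has `𝓛⁻Y = 𝓛Y − 2β₂·conj Y`, hence
`‖𝓛⁻Y‖₂ ≤ ‖𝓛Y‖₂ + 2b₂‖Y‖₂` (`Y ∈ C¹_c`).  (Needed because `𝓛(i·B) = i·𝓛⁻B`.) [folklore] -/
theorem l2_modelOperator_negConj_le {q : ℝ} (hq : 0 < q) (G : ℝ) {Y : ℝ → ℂ} (hY : ContDiff ℝ 1 Y) (hYs : HasCompactSupport Y)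
    {w : ℝ → ℝ} (hwc : Continuous w) {β₁ β₂ : ℝ → ℂ} (hβ₁c : Continuous β₁) (hβ₂c : Continuous β₂) {b₁ b₂ : ℝ}
    (hb₁ : ∀ τ, ‖β₁ τ‖ ≤ b₁) (hb₂ : ∀ τ, ‖β₂ τ‖ ≤ b₂) :
    (∫ y : ℝ, ‖I * (G : ℂ) * ((2 / q : ℂ) * Y y
            - ∫ σ : ℝ, ((((2 * q - (y - σ) ^ 2) * (((y - σ) ^ 2 + q) ^ (5 / 2 : ℝ))⁻¹ : ℝ)) : ℂ) * Y σ)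
          - ((w y : ℝ) : ℂ) * deriv Y y + β₁ y * Y y + -β₂ y * conj (Y y)‖ ^ 2) ^ (1 / 2 : ℝ)
      ≤ (∫ y : ℝ, ‖I * (G : ℂ) * ((2 / q : ℂ) * Y y
            - ∫ σ : ℝ, ((((2 * q - (y - σ) ^ 2) * (((y - σ) ^ 2 + q) ^ (5 / 2 : ℝ))⁻¹ : ℝ)) : ℂ) * Y σ)
          - ((w y : ℝ) : ℂ) * deriv Y y + β₁ y * Y y + β₂ y * conj (Y y)‖ ^ 2) ^ (1 / 2 : ℝ)
        + 2 * b₂ * (∫ y : ℝ, ‖Y y‖ ^ 2) ^ (1 / 2 : ℝ) := by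
  have hL2 := memLp_modelOperator hq G hY hYs hwc hβ₁c hβ₂c hb₁ hb₂
  have hY2 : MemLp Y 2 volume := hY.continuous.memLp_of_hasCompactSupport hYs
  have hbd : ∀ τ, ‖2 * β₂ τ‖ ≤ 2 * b₂ := fun τ => by
    rw [norm_mul, Complex.norm_ofNat]; exact mul_le_mul_of_nonneg_left (hb₂ τ) (by norm_num)
  have hC2 : MemLp (fun y : ℝ => 2 * β₂ y * conj (Y y)) 2 volume :=
    memLp_boundedMultiplier_mul (β := fun y => 2 * β₂ y) (hβ₂c.const_mul (2 : ℂ) |>.aestronglyMeasurable) hbd (memLp_conj hY2)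
  have e : ∀ y : ℝ, I * (G : ℂ) * ((2 / q : ℂ) * Y y
            - ∫ σ : ℝ, ((((2 * q - (y - σ) ^ 2) * (((y - σ) ^ 2 + q) ^ (5 / 2 : ℝ))⁻¹ : ℝ)) : ℂ) * Y σ)
          - ((w y : ℝ) : ℂ) * deriv Y y + β₁ y * Y y + -β₂ y * conj (Y y)
        = (I * (G : ℂ) * ((2 / q : ℂ) * Y y
            - ∫ σ : ℝ, ((((2 * q - (y - σ) ^ 2) * (((y - σ) ^ 2 + q) ^ (5 / 2 : ℝ))⁻¹ : ℝ)) : ℂ) * Y σ)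
          - ((w y : ℝ) : ℂ) * deriv Y y + β₁ y * Y y + β₂ y * conj (Y y)) - 2 * β₂ y * conj (Y y) := fun y => by ring
  simp_rw [e]
  refine (l2_sub_le hL2 hC2).trans ?_
  have hconj : ∫ y : ℝ, ‖conj (Y y)‖ ^ 2 = ∫ y : ℝ, ‖Y y‖ ^ 2 := by
    refine integral_congr_ae (ae_of_all _ fun y => ?_); simp only [Complex.norm_conj]
  have h := l2_boundedMultiplier_le (β := fun y => 2 * β₂ y) (f := fun y => conj (Y y)) hbd (memLp_conj hY2)
  rw [hconj] at h
  linarith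

/-! ## §3 The transform of a two-kernel piece -/

/-- **`(a∗Y + i·b∗Y)^(z) = (χ_a(z) + iχ_b(z))·Ŷ(z)`** for real `a, b ∈ L¹` with `∫a e^{izt} = χ_a(z)`, `∫b e^{izt} = χ_b(z)`, `Y ∈ C_c`.
[folklore] -/
theorem transform_twoKernelPiece_eq {a b : ℝ → ℝ} (hai : Integrable a) (hbi : Integrable b) {χa χb : ℝ → ℂ}
    (haχ : ∀ z : ℝ, ∫ t : ℝ, ((a t : ℝ) : ℂ) * cexp (I * z * t) = χa z)
    (hbχ : ∀ z : ℝ, ∫ t : ℝ, ((b t : ℝ) : ℂ) * cexp (I * z * t) = χb z)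
    {Y : ℝ → ℂ} (hYc : Continuous Y) (hYs : HasCompactSupport Y) (z : ℝ) :
    ∫ x : ℝ, ((∫ y : ℝ, ((a (x - y) : ℝ) : ℂ) * Y y) + I * ∫ y : ℝ, ((b (x - y) : ℝ) : ℂ) * Y y) * cexp (I * z * x)
      = (χa z + I * χb z) * ∫ x : ℝ, Y x * cexp (I * z * x) := by
  have hYi : Integrable Y := hYc.integrable_of_hasCompactSupport hYs
  have hA1 := integrable_piece hai hYc hYs
  have hB1 := integrable_piece hbi hYc hYs
  have he : ∀ x : ℝ, ‖cexp (I * z * x)‖ ≤ 1 := fun x => by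
    rw [show I * (z : ℂ) * (x : ℂ) = ((z * x : ℝ) : ℂ) * I by push_cast; ring, Complex.norm_exp_ofReal_mul_I]
  have hem : AEStronglyMeasurable (fun x : ℝ => cexp (I * z * x)) volume :=
    (Complex.continuous_exp.comp (continuous_const.mul Complex.continuous_ofReal)).aestronglyMeasurable
  have hIA : Integrable fun x : ℝ => (∫ y : ℝ, ((a (x - y) : ℝ) : ℂ) * Y y) * cexp (I * z * x) :=
    hA1.mul_bdd hem (ae_of_all _ he)
  have hIB : Integrable fun x : ℝ => (I * ∫ y : ℝ, ((b (x - y) : ℝ) : ℂ) * Y y) * cexp (I * z * x) :=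
    (hB1.const_mul I).mul_bdd hem (ae_of_all _ he)
  have hca := unnormalisedTransform_conv (k := fun t => ((a t : ℝ) : ℂ)) hai.ofReal hYi z
  have hcb := unnormalisedTransform_conv (k := fun t => ((b t : ℝ) : ℂ)) hbi.ofReal hYi z
  beta_reduce at hca hcb
  rw [haχ z] at hca
  rw [hbχ z] at hcb
  have e2 : ∫ x : ℝ, (I * ∫ y : ℝ, ((b (x - y) : ℝ) : ℂ) * Y y) * cexp (I * z * x)
      = I * ∫ x : ℝ, (∫ y : ℝ, ((b (x - y) : ℝ) : ℂ) * Y y) * cexp (I * z * x) := by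
    rw [← integral_const_mul]
    refine integral_congr_ae (ae_of_all _ fun x => ?_); ring
  simp_rw [add_mul]
  rw [integral_add hIA hIB, e2, hca, hcb]
  ring

end Summit.NavierStokesRegularity.NavierStokesRegularity.Theorems.MatchedKernel

end
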